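import Mathlib
import Summits.Ventures.PercRepro2.Defs
import Summits.Ventures.PercRepro2.Graph
import Summits.Ventures.PercRepro2.OneColourSwitch
import Summits.Ventures.PercRepro2.RegionHubSign
import Summits.Ventures.PercRepro2.SideSwitch
import Summits.Ventures.PercRepro2.SideSwitchFibre
import Summits.Ventures.PercRepro2.SideSwitchComps
import Summits.Ventures.PercRepro2.M9LatticeHarrisGen
import Summits.Ventures.PercRepro2.M9LatticeHarrisSub
import Summits.Ventures.PercRepro2.TermSwitchDefs
import Summits.Ventures.PercRepro2.TermSwitchReach
import Summits.Ventures.PercRepro2.M9NoPocketDefs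
import Summits.Ventures.PercRepro2.M9NoPocketWorld
import Summits.Ventures.PercRepro2.M9NoPocketWorldD
import Summits.Ventures.PercRepro2.M9NoPocketLegal
import Summits.Ventures.PercRepro2.M9NoPocketFibre
import Summits.Ventures.PercRepro2.M9NoPocketMono
import Summits.Ventures.PercRepro2.M9NoPocketCompl
import Summits.Ventures.PercRepro2.M9NoPocketFlipRS
import Summits.Ventures.PercRepro2.M9NoPocketCompl2
import Summits.Ventures.PercRepro2.M9NoPocketHarris
import Summits.Ventures.PercRepro2.M9NoPocketM9
import Summits.Ventures.PercRepro2.M9GeneralDSplit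
import Summits.Ventures.PercRepro2.M9NoPocketDirty

/-!
# The hub–dead-end sum is non-positive on the no-pocket class (blind cell PercRepro2, p3 g35,
2026-08-29; `proofs/P3-NPHDR.md` §2)

The Harris step of `M9NoPocketM9` runs representative by representative, and the outside flip
pairs the representatives.  Hence the single-`d` sum restricted to any set of representatives
that is invariant under the outside flip is non-positive (`sum_repD_filter_nonpos`).  Since a
legal assignment is a hub–dead-end point exactly when its representative has a dead edge and a
source (`HD_assignX_iff`, a predicate invariant under the outside flip), the hub–dead-end sum
`hdSum = Σ_{HD} σ_pq σ_rs` is the restricted sum over those representatives: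
**`hdSum ≤ 0` under the no-pocket hypothesis** (`hdSum_nonpos_of_noPocket`) — CONJECTURE HDR
of `proofs/P3-HDR.md` on the class of graphs in which every neighbour of `d` other than
`r, s` is adjacent to `r` or `s` (`T`-edges allowed).  Own work; std axioms.
-/

namespace Summit.Ventures.PercRepro2

namespace NoPocket

open Finset Classical RegionHub OneColourSwitch SideSwitch TermSwitch

variable {V : Type*} {E : Type*}

section Restricted

variable [Fintype V] [DecidableEq V] [Fintype E] [DecidableEq E] {ends : E → Sym2 V}

/-- **The per-representative Harris step** of `M9NoPocketM9`, stated on its own: for a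
representative `ρ`, `Σ_{x legal} (σ_pq(ρ_x) + σ_pq(ρ^O_x)) · σ_rs(ρ_x) ≤ 0`. -/
lemma fibre_harris_nonpos {p q r s d : V} (hnp : NoPocketAt ends d r s) (hpd : p ≠ d)
    (hqd : q ≠ d) (hr : d ≠ r) (hs : d ≠ s) {ρ : Config E} (hρ : ρ ∈ RepD ends p q r s d) :
    ∑ x ∈ L4 ends d r s ρ,
      (sigma ends (assignX ends x ρ) p q + sigma ends (assignX ends x (flipOp ends d r s ρ)) p q) *
        sigma ends (assignX ends x ρ) r s ≤ 0 := by
  have hρO := flipOp_mem_RepD hr hs hρ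
  have hGmono : ∀ x ∈ L4 ends d r s ρ, ∀ x' ∈ L4 ends d r s ρ, x ≤ x' →
      Gfun ends p q r s d ρ x ≤ Gfun ends p q r s d ρ x' := by
    intro x hx x' hx' hxx'
    have hxO : x ∈ L4 ends d r s (flipOp ends d r s ρ) := by rw [L4_flipOp hr hs]; exact hx
    have hx'O : x' ∈ L4 ends d r s (flipOp ends d r s ρ) := by rw [L4_flipOp hr hs]; exact hx'
    unfold Gfun Yc
    exact add_le_add (ite_le_ite_of_imp (conn_pq_assignX_mono hnp hpd hqd hr hs hρ hxx' hx hx'))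
      (ite_le_ite_of_imp (conn_pq_assignX_mono hnp hpd hqd hr hs hρO hxx' hxO hx'O))
  have hHanti : ∀ x ∈ L4 ends d r s ρ, ∀ x' ∈ L4 ends d r s ρ, x ≤ x' →
      sigma ends (assignX ends x' ρ) r s ≤ sigma ends (assignX ends x ρ) r s := by
    intro x hx x' hx' hxx'
    unfold sigma
    exact sub_le_sub (ite_le_ite_of_imp (conn_rs_assignX_anti hnp hpd hqd hr hs hρ hxx' hx hx'))
      (ite_le_ite_of_imp (conn_rs_compl_assignX_mono hnp hpd hqd hr hs hρ hxx' hx hx'))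
  have hH := sum_sub_dual_mul_nonpos_of_sublattice''
    (L := L4 ends d r s ρ) (c := cdual ends d r s ρ)
    (fun x hx => cdual_cdual ((mem_L4.1 hx).1.1) ((mem_L4.1 hx).1.2)) (cdual_antitone ρ)
    (fun _ _ hx hx' => L4_sup_mem hx hx') (fun _ _ hx hx' => L4_inf_mem hx hx')
    (fun _ hx => cdual_mem_L4 hx) (G := Gfun ends p q r s d ρ)
    (H := fun x => sigma ends (assignX ends x ρ) r s) hGmono hHanti
  refine le_trans (le_of_eq ?_) hH
  refine Finset.sum_congr rfl (fun x hx => ?_)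
  rw [sigma_pq_add_flipOp hnp hpd hqd hr hs hρ hx]

/-- **The single-`d` sum restricted to a set of representatives invariant under the outside
flip is non-positive.** -/
theorem sum_repD_filter_nonpos {p q r s d : V} (hnp : NoPocketAt ends d r s) (hpd : p ≠ d)
    (hqd : q ≠ d) (hr : d ≠ r) (hs : d ≠ s) (P : Config E → Prop)
    (hP : ∀ ρ ∈ RepD ends p q r s d, (P (flipOp ends d r s ρ) ↔ P ρ)) :
    ∑ ρ ∈ (RepD ends p q r s d).filter P, ∑ x ∈ L4 ends d r s ρ,
      sigma ends (assignX ends x ρ) p q * sigma ends (assignX ends x ρ) r s ≤ 0 := by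
  have hbij : ∀ ρ ∈ (RepD ends p q r s d).filter P,
      flipOp ends d r s ρ ∈ (RepD ends p q r s d).filter P := by
    intro ρ hρ
    obtain ⟨hρ', hPρ⟩ := Finset.mem_filter.1 hρ
    exact Finset.mem_filter.2 ⟨flipOp_mem_RepD hr hs hρ', (hP ρ hρ').2 hPρ⟩
  have hsumO : (∑ ρ ∈ (RepD ends p q r s d).filter P, ∑ x ∈ L4 ends d r s ρ,
        sigma ends (assignX ends x ρ) p q * sigma ends (assignX ends x ρ) r s) =
      ∑ ρ ∈ (RepD ends p q r s d).filter P, ∑ x ∈ L4 ends d r s ρ,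
        sigma ends (assignX ends x (flipOp ends d r s ρ)) p q *
          sigma ends (assignX ends x ρ) r s := by
    symm
    refine Finset.sum_nbij' (fun ρ => flipOp ends d r s ρ) (fun ρ => flipOp ends d r s ρ)
      hbij hbij (fun ρ _ => flipOp_flipOp hr hs ρ) (fun ρ _ => flipOp_flipOp hr hs ρ) ?_
    intro ρ hρ
    have hρ' := (Finset.mem_filter.1 hρ).1
    rw [L4_flipOp hr hs]
    refine Finset.sum_congr rfl (fun x hx => ?_)
    rw [sigma_rs_assignX_flipOp hnp hr hs hρ' hx]
  have htwice : 2 * (∑ ρ ∈ (RepD ends p q r s d).filter P, ∑ x ∈ L4 ends d r s ρ,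
      sigma ends (assignX ends x ρ) p q * sigma ends (assignX ends x ρ) r s) ≤ 0 := by
    calc 2 * (∑ ρ ∈ (RepD ends p q r s d).filter P, ∑ x ∈ L4 ends d r s ρ,
          sigma ends (assignX ends x ρ) p q * sigma ends (assignX ends x ρ) r s)
        = (∑ ρ ∈ (RepD ends p q r s d).filter P, ∑ x ∈ L4 ends d r s ρ,
            sigma ends (assignX ends x ρ) p q * sigma ends (assignX ends x ρ) r s) +
          ∑ ρ ∈ (RepD ends p q r s d).filter P, ∑ x ∈ L4 ends d r s ρ,
            sigma ends (assignX ends x (flipOp ends d r s ρ)) p q *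
              sigma ends (assignX ends x ρ) r s := by
          rw [← hsumO]; ring
      _ = ∑ ρ ∈ (RepD ends p q r s d).filter P, ∑ x ∈ L4 ends d r s ρ,
            (sigma ends (assignX ends x ρ) p q +
              sigma ends (assignX ends x (flipOp ends d r s ρ)) p q) *
              sigma ends (assignX ends x ρ) r s := by
          rw [← Finset.sum_add_distrib]
          refine Finset.sum_congr rfl (fun ρ _ => ?_)
          rw [← Finset.sum_add_distrib]
          refine Finset.sum_congr rfl (fun x _ => ?_)
          ring
      _ ≤ 0 := Finset.sum_nonpos (fun ρ hρ =>
          fibre_harris_nonpos hnp hpd hqd hr hs (Finset.mem_filter.1 hρ).1)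
  linarith

end Restricted

section HDR

variable [Fintype V] [DecidableEq V] [Fintype E] [DecidableEq E] {ends : E → Sym2 V}

omit [Fintype V] [DecidableEq V] in
/-- The hub–dead-end sum is the sum over the `Sep ∧ DOne` colourings of the `HD`-indicator
times the sign. -/
lemma hdSum_eq_sum_dOneSet {p q r s d : V} :
    hdSum ends p q r s d = ∑ ω ∈ DOneSet ends p q r s d,
      (if HD ends p q r s d ω then sigma ends ω p q * sigma ends ω r s else 0) := by
  unfold hdSum
  symm
  apply Finset.sum_subset (Finset.subset_univ _)
  intro ω _ hω
  rw [if_neg]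
  intro hHD
  obtain ⟨hsep, hD, _, _⟩ := hHD
  exact hω (mem_DOneSet.2 ⟨hsep, hD⟩)

/-- **CONJECTURE HDR on the no-pocket class**: for every finite marked multigraph and every
non-mark `d` whose neighbours other than `r, s` are adjacent to `r` or `s`, the hub–dead-end
sum `Σ_{HD} σ_pq · σ_rs` is non-positive. -/
theorem hdSum_nonpos_of_noPocket {p q r s d : V} (hnp : NoPocketAt ends d r s) (hpd : p ≠ d)
    (hqd : q ≠ d) (hr : d ≠ r) (hs : d ≠ s) : hdSum ends p q r s d ≤ 0 := by
  rw [hdSum_eq_sum_dOneSet, sum_dOne_eq_sum_repD_L4 hnp hpd hqd hr hs]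
  have h2 : ∀ ρ ∈ RepD ends p q r s d,
      (∑ x ∈ L4 ends d r s ρ, if HD ends p q r s d (assignX ends x ρ) then
          sigma ends (assignX ends x ρ) p q * sigma ends (assignX ends x ρ) r s else 0) =
        if hasDead ends d r s ρ ∧ hasSource ends d r s ρ then
          ∑ x ∈ L4 ends d r s ρ,
            sigma ends (assignX ends x ρ) p q * sigma ends (assignX ends x ρ) r s
        else 0 := by
    intro ρ hρ
    by_cases hP : hasDead ends d r s ρ ∧ hasSource ends d r s ρ
    · rw [if_pos hP]
      refine Finset.sum_congr rfl (fun x hx => ?_)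
      rw [if_pos ((HD_assignX_iff hnp hpd hqd hr hs hρ hx).2 hP)]
    · rw [if_neg hP]
      refine Finset.sum_eq_zero (fun x hx => ?_)
      rw [if_neg (fun h => hP ((HD_assignX_iff hnp hpd hqd hr hs hρ hx).1 h))]
  rw [Finset.sum_congr rfl h2, ← Finset.sum_filter]
  convert sum_repD_filter_nonpos hnp hpd hqd hr hs
    (fun ρ => hasDead ends d r s ρ ∧ hasSource ends d r s ρ)
    (fun ρ _ => by rw [hasDead_flipOp hr hs, hasSource_flipOp hr hs]) using 2
  ext ρ
  simp only [Finset.mem_filter]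

/-- The single-`d` statement on the no-pocket class, re-derived through `HD ≤ 0`
(`dSignSum_nonpos_of_hdSum_nonpos` of `M9GeneralDSplit`). -/
theorem dSignSum_nonpos_of_noPocket' {p q r s d : V} (hnp : NoPocketAt ends d r s) (hpd : p ≠ d)
    (hqd : q ≠ d) (hr : d ≠ r) (hs : d ≠ s) : dSignSum ends p q r s d ≤ 0 :=
  dSignSum_nonpos_of_hdSum_nonpos (Ne.symm hr) (Ne.symm hs) (hdSum_nonpos_of_noPocket hnp hpd hqd hr hs)

end HDR

end NoPocket

end Summit.Ventures.PercRepro2
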